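import Literature.MathematicalPhysics.QuantumFieldTheory.Balaban1983to89.B9SupplySockB9P3ZdH2Per
import Literature.MathematicalPhysics.QuantumFieldTheory.Balaban1983to89.B8TowerBondsPrinted

/-!
# `Balaban1983to89.B9SupplySockB9P3ZdH2PerClass` — THE BOTH-POINTS PERIODIC SOCKET `SockB9P3H2Per` SUPPLIED AT A GENERIC DATUM CLASS `ΛbP`, IN PARTICULAR AT
# PRINT'S CLASS (1.31) `fun m l => towerBondsP L i.Ω (i.Λs m) l` — the class-map-generic twin of this seat's g23 `B9SupplySockB9P3ZdH2Per.sockB9P3H2Per_at_univ ∕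
# _opsAllZdPer_of_binders` (which conclude at the member's own class `i.Λb`), asked for by dag-n05-d g15 LOCATED-JUNCTION-SHAPE (I.≈42700, 2026-08-28T20:15Z)

statement-level skeleton of published theorems with citation tags; proofs where landed; nothing here is a claim about the
Yang–Mills mass gap

`[Balaban1985RegularSpaces]` ("B8", CMP **98**) (1.58)–(1.59) p. 86, Prop. 3 p. 87, (1.31) p. 82, (1.38)–(1.39) p. 82, (1.42) p. 83, p. 77 *«Ω_j = T_η»*.
`[Balaban1985BackgroundPropagators]` ("B9", CMP **99**) Thm 3.3 p. 399, (3.42) p. 397, (3.43)–(3.47) p. 398, (3.26)–(3.27) p. 395, (3.40) p. 397, Thm 3.11 p. 416,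
(3.69) p. 404, (3.16) p. 393.  `[Balaban1984PropagatorsII]` (2.3) p. 224.  PDF held: `paper:balaban1985-cmp99-background-propagators` pp. 394–399.

CITATION HEADER (lean-in-tree rule).  Cell `pub-ymgap` (YM Track A), DAG node N06 = [B9], seat `pub-ymgap-dag-n06-b` (g24), the (β′-PERIODIC) road.  TRIGGER (t2):
dag-n05-d g15 INTENT-(13)′α «LOCATED-JUNCTION-SHAPE: the UNSOURCED both-points socket's N06 suppliers conclude at the member's OWN class `i.Λb`, while every
N05 consumer of record reads print's class `fun m l => towerBondsP L Ω (Λs m) l`; `wsup` is a real `iSup` so no one-line class-monotonicity bridge — the cure is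
the class-map-generic twin of `sockB9P3H2Per_at_univ` (`havg : AvgAtP L ops q ΛbP M i m`, conclusion at `ΛbP`)».  THIS FILE is exactly that: g23's theorem and
its genuine-record edition with the three textual occurrences of `i.Λb` replaced by a class-map parameter `ΛbP` (proof VERBATIM otherwise — the chain reads the
class only through `AvgAtP`'s `|B₁|` term), plus the edition at print's class.  Nothing is re-declared; g23's file is imported, not modified.

WHAT IS PROVED (kernel, 0 sorry; no `def`, no `instance`, no `notation`).
* §1 ★★★ `sockB9P3H2Per_at_univ_class` — at a member `(M, i, m)` with `i.Ω 0 = ℤᵈ` and ANY class map `ΛbP`: `InvAtHIPer aI` + `CurvAtInAk c₆₉` + `LandauAtUPer` +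
  `AvgAtP q ΛbP` + `GlobAtIPer aT B₀` + `HolderAtIH2Per aT C_β β len` + `PerAtU` ⟹ `SockB9P3H2Per P L B₀′ B₀β′ cP β len i.η m i.Ω i.Λs ΛbP`
  (`B₀′ = max{1, 2B₀max{1,q}}`, `B₀β′ = 2·max{0,C_β}·max{1,q}`, `cP = min{1∕16, aI, aT, 1∕(2B₀c₆₉M+1)}`).
* §2 ★★★ `sockB9P3H2Per_opsAllZdPer_of_binders_class` — for the genuine torus record `opsAllZdPer τ L P ΛbP ops₀` (Q′ᵀQ′ of the class `ΛbP`): `PerAtU`, `CurvAtInAk`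
  (c₆₉ = 14(d−1)), `AvgAtP` (q = qQ d L C_τ β_τ s, EDITION P₀'s law `LevelSepPP0 L m i.Ω ΛbP s`), `LandauAtUPer` DISCHARGED; displayed: `InvAtHIPer`, `GlobAtIPer`,
  `HolderAtIH2Per`.
* §3 ★★★ `sockB9P3H2Per_opsAllZdPer_towerBondsP` — §2 at `ΛbP := fun m l => towerBondsP L i.Ω (i.Λs m) l`: the N05 consumers' displayed hypothesis
  `SockB9P3H2Per P L B₀ B₀β cP β len i.η m i.Ω i.Λs (fun m l => towerBondsP L i.Ω (i.Λs m) l)` from the three analytic binders at the record over print's class.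

HONEST SCOPE.  (i) Supplier ∕ packaging: NO estimate of [B9] is proved; the three analytic binders are DISPLAYED (theorems of this seat only at `torusIdx`, whose
class is `torusLamb`, not a nested member's `towerBondsP`).  (ii) Constants binder-dependent.  (iii) Count-neutral; N05 ∕ N06 NOT discharged; K1⁹ `stmt-QuantumFields-27364`
NOT closed; one finite `𝕋⁴` programme at fixed `ε`, Bałaban as printed; R4 closes only the conditional finite-`𝕋⁴` rung `BalabanLadder.UV` — nothing continuum ∕ ℝ⁴ ∕
OS ∕ mass gap ∕ Clay.  Unit `pub-ymgap-dag-n06-b` (g24), 2026-08-28.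
-/

noncomputable section

namespace Literature.MathematicalPhysics.QuantumFieldTheory.Balaban1983to89.B9SupplySockB9P3ZdH2PerClass

open B7Prop1Explicit B7Prop2Explicit
open B7Prop1Local (InBox loK bondHiK)
open B7Prop4GeneralLevels (linCovIter)
open B8Ineq132 (covDerivFwd covDeriv InAk BondTouches)
open B8Eq184Proof (cfgExp)
open B8Lemma1NonAbelian (mulCfg)
open B8Eq140Level (SideTouches)
open B8Eq146AExpansion (iEta plaqCovDeriv)
open B8Eq143PlaqExpansion (pdiv)
open B8Eq155JBound (Jcur wsup)
open B8ScaledSupNorm (bondNorm msup weight Bdd)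
open B8Eq138LandauZd (IsLandau138 IsLandau138W covLap)
open B8LeafModelZd (ZdIdx)
open B8LeafModelZd3SockPer (SockB9P3Per)
open B8LeafModelZd3SockH2Per (SockB9P3H2Per)
open B9Eq340HolderZd (hquot AdmPair)
open B9SupplySockB9P3ZdLetters (OpsZd deltaAOf)
open B9SupplySockB9P3ZdLettersOmega (OnDom)
open B9SupplySockB9P3Zd (landau_of_landauW norm_Jcur_le_of_grad bdd_neg_three_of_pointwise apriori_arith)
open B9SupplySockB9P3ZdGammaInAk (CurvAtInAk)
open B9SupplySockB9P3ZdGammaInAkDpZd (withDpZd curvAtInAk_of_Dp_eq)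
open B9SupplySockB9P3ZdGammaUniv (AvgAtP)
open B9SupplySockB9P3ZdDatum (LandauAtU GlobAtI)
open B9Eq316AveragingTransposeZd (betaTau qQ)
open B9Eq316AveragingTransposeZdPrinted (withQQP)
open B9Eq316AveragingTransposeZdLevelZero (LevelSepPP0 avgAtP_withQQP₀)
open B9Eq327GreenZdHermPer (domSubHPer PerPreservingAt InvAtHIPer bondTouches_univ)
open B9SupplySockB9P3ZdAllLettersZdPer (opsAllZdPer opsAllZdPer_DRDs perPreservingAt_opsAllZdPer)
open B9SupplySockB9P3ZdPer (LandauAtUPer GlobAtIPer HolderAtIPer PerAtU perAtU_opsAllZdPer curvAtInAk_opsAllZdPer avgAtP_opsAllZdPer₀ landauAtUPer_opsAllZdPer)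
open B9SupplySockB9P3ZdH2Per (HolderAtIH2Per)
open B8TowerBondsPrinted (towerBondsP)
open T4TermwiseTorus (IsPeriodic)

-- `Site` alone could resolve to the torus sites of `Setup.lean`; re-export the `ℤ^d` sites of `B7Prop1Explicit`.
export B7Prop1Explicit (Site)

variable {d : ℕ} {𝔸 : Type*} [CStarAlgebra 𝔸]

/-! ## §1  The both-points supplier at a generic class map -/

section Supply

variable [Nontrivial 𝔸] (P L : ℕ) (ops : ℝ → ZdIdx d L → ℕ → OpsZd d 𝔸)

/-- ★★★ **THE PERIODIC-GUARDED BOTH-POINTS SOCKET AT ONE PERIODIC MEMBER, GENERIC DATUM CLASS `ΛbP`** — g23's `B9SupplySockB9P3ZdH2Per.sockB9P3H2Per_at_univ`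
with the member's own class `i.Λb` replaced by a class-map parameter `ΛbP : ℕ → ℕ → Set (Site d × Fin d)` in `AvgAtP` and in the conclusion's `|B₁|` term; the
proof is g23's VERBATIM ([B8] p. 86: `A′ = G(U₀)J̃`, `|J̃|₍₋₃₎ ≤ |J|₍₋₃₎ + c₆₉Mα₀|A′|₍₋₁₎ + q|B₁|`, a-priori step with `θ ≤ ½`).
[cite: Balaban1985RegularSpaces, (1.58)–(1.59) p.86, Prop. 3 p.87, (1.31) p.82, (1.38)–(1.39) p.82, (1.42) p.83, p.77 («Ω_j = T_η»); Balaban1985BackgroundPropagators, Thm 3.3 p.399, (3.26)–(3.27) p.395, (3.40) p.397, (3.42) p.397, (3.43)–(3.47) p.398, Thm 3.11 p.416; Balaban1984PropagatorsII, (2.3) p.224] -/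
theorem sockB9P3H2Per_at_univ_class [NeZero P] (hd2 : 2 ≤ d) (hL : 1 ≤ L) {c69 q aI aT B₀ Cβ β : ℝ} {len : Site d → ℝ}
    {M : ℝ} (hM1 : 1 ≤ M) (i : ZdIdx d L) (hΩ : i.Ω 0 = Set.univ) {m : ℕ}
    (hinv : InvAtHIPer P L ops aI M i m) (hcurv : CurvAtInAk L ops c69 M i m) (hlan : LandauAtUPer P L ops M i m)
    (ΛbP : ℕ → ℕ → Set (Site d × Fin d)) (havg : AvgAtP L ops q ΛbP M i m) (hglob : GlobAtIPer P L ops aT B₀ M i m) (hhol : HolderAtIH2Per P L ops aT Cβ β len M i m)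
    (hper : PerAtU P L ops M i m) (hc69 : 0 ≤ c69) (hq : 0 ≤ q) (hB₀ : 0 < B₀) :
    SockB9P3H2Per (𝔸 := 𝔸) P L (max 1 (2 * B₀ * max 1 q)) (2 * max 0 Cβ * max 1 q)
      (min (1 / 16) (min aI (min aT (1 / (2 * B₀ * c69 * M + 1))))) β len i.η m i.Ω i.Λs ΛbP := by
  intro α₀ α₂ hα₀ hα₀c hα₂ hα₂c U₀ W hU₀ hWu hU₀p _ hInA _ hLanW A' hsa hA'p h41 hA0
  -- the thresholds
  have hη : 0 < i.η := i.hη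
  have hLr : (1 : ℝ) ≤ L := by exact_mod_cast hL
  have hM0 : 0 < M := lt_of_lt_of_le one_pos hM1
  simp only [le_min_iff] at hα₀c hα₂c
  obtain ⟨-, hα₀I, hα₀T, hα₀θ⟩ := hα₀c
  obtain ⟨hα₂16, -, -, -⟩ := hα₂c
  have hκ' : 0 ≤ c69 * M * α₀ := by positivity
  have hθ : B₀ * (c69 * M * α₀) ≤ 1 / 2 := by
    have hpos : 0 < 2 * B₀ * c69 * M + 1 := by positivity
    have h1 : α₀ * (2 * B₀ * c69 * M + 1) ≤ 1 := (le_div_iff₀ hpos).1 hα₀θ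
    nlinarith [hα₀.le, hB₀.le, hκ']
  have hU₀1 : ∀ x κ, U₀ x κ ∈ U1 𝔸 := fun x κ => unitaryUnits_le_U1 (hU₀ x κ)
  -- every bond touches `Ω₀ = ℤᵈ`
  have hb0 : ∀ (y : Site d) (τ : Fin d), BondTouches (i.Ω 0) y τ := fun y τ => by rw [hΩ]; exact bondTouches_univ y τ
  -- A′ is a field of the class E(Ω₀), periodic and Hermitian
  have hAbd : Bdd L m i.η (-(1 : ℝ)) (fun j (b : Site d × Fin d) => SideTouches (i.Ω j) b.1 b.2) (fun b => A' b.1 b.2) := by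
    have e1 : (-(1 : ℝ)) = -((1 : ℕ) : ℝ) := by norm_num
    rw [e1]
    refine B8ScaledSupNorm.bdd_of_forall (c := α₂) fun j hj b hb => ?_
    rw [B8ScaledSupNorm.weight_neg_natCast, pow_one]
    have h := (h41 j hj b.1 b.2 hb).2
    have hs : 0 < (L : ℝ) ^ j * i.η := B8ScaledSupNorm.scale_pos hL hη j
    calc (L : ℝ) ^ j * i.η * ‖A' b.1 b.2‖ ≤ (L : ℝ) ^ j * i.η * (α₂ * ((L : ℝ) ^ j * i.η)⁻¹) :=
          mul_le_mul_of_nonneg_left h hs.le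
      _ = α₂ := by rw [mul_comm α₂, ← mul_assoc, mul_inv_cancel₀ hs.ne', one_mul]
  have hOn : OnDom L m i.η i.Ω A' := ⟨fun y τ h => absurd (hb0 y τ) h, hAbd⟩
  obtain ⟨a, ha_def⟩ : ∃ a : ℝ,
      a = msup L m i.η (-(1 : ℝ)) (fun j (b : Site d × Fin d) => SideTouches (i.Ω j) b.1 b.2) (fun b => A' b.1 b.2) :=
    ⟨_, rfl⟩
  have ha0 : 0 ≤ a := by rw [ha_def]; exact B8ScaledSupNorm.msup_nonneg L m hη.le _ _ _
  -- the Landau condition for A′; the source J̃ = Δ_a(U₀)A′ and A′ = G(U₀)J̃ ((1.58))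
  have hLanA : IsLandau138 L m i.η (i.Ω 0) (i.Λs m) U₀ A' := landau_of_landauW hd2 hη U₀ hWu hα₂16 h41 hLanW
  obtain ⟨Jt, hJt_def⟩ : ∃ Jt : Site d → Fin d → 𝔸, Jt = deltaAOf i.η (ops M i m) U₀ A' := ⟨_, rfl⟩
  have hJtper : Jt ∈ domSubHPer (d := d) (𝔸 := 𝔸) P := by
    rw [hJt_def]; exact hper U₀ hU₀ hU₀p A' ⟨hA'p, hsa⟩
  have hGJ : (ops M i m).Gop U₀ Jt = A' := by
    rw [hJt_def]; exact hinv α₀ U₀ hU₀ hU₀p hα₀I hInA A' hA'p hOn hsa _ fun y τ _ => rfl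
  have hDRD : ∀ (x : Site d) (μ : Fin d), (ops M i m).DRDs U₀ A' x μ = 0 := hlan U₀ hU₀ hU₀p A' hA'p hOn hLanA
  have hJtb : ∀ (x : Site d) (μ : Fin d),
      Jt x μ = Jcur i.η U₀ A' μ x + (ops M i m).Dp U₀ A' x μ + (ops M i m).DRDs U₀ A' x μ + (ops M i m).QQ U₀ A' x μ := by
    intro x μ; rw [hJt_def]; rfl
  -- the right-hand side of the socket: |J|₍₋₃₎ and |B₁|
  obtain ⟨nJ, hnJ_def⟩ : ∃ nJ : ℝ, nJ = bondNorm L m i.η (-(3 : ℝ)) i.Ω (fun x μ => Jcur i.η U₀ A' μ x) := ⟨_, rfl⟩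
  obtain ⟨nB, hnB_def⟩ : ∃ nB : ℝ, nB = wsup 1 (fun p : {p : ℕ × (Site d × Fin d) // p.1 ≤ m ∧ p.2 ∈ ΛbP m p.1} =>
      linCovIter L U₀ (iEta i.η A') p.1.1 p.1.2.1 p.1.2.2) := ⟨_, rfl⟩
  have hnJ0 : 0 ≤ nJ := by rw [hnJ_def]; exact B8ScaledSupNorm.msup_nonneg L m hη.le _ _ _
  have hnB0 : 0 ≤ nB := by rw [hnB_def]; exact B8Eq155JBound.wsup_nonneg zero_le_one _
  -- J is bounded (A′ is): the real supremum |J|₍₋₃₎ is attained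
  have hAglob : ∀ (y : Site d) (τ : Fin d), ‖A' y τ‖ ≤ α₂ * i.η⁻¹ := by
    intro y τ
    by_cases hmem : ∃ j, j ≤ m ∧ SideTouches (i.Ω j) y τ
    · obtain ⟨j, hj, hs⟩ := hmem
      have hLj : (1 : ℝ) ≤ (L : ℝ) ^ j := one_le_pow₀ hLr
      calc ‖A' y τ‖ ≤ α₂ * ((L : ℝ) ^ j * i.η)⁻¹ := (h41 j hj y τ hs).2
        _ = α₂ * i.η⁻¹ * ((L : ℝ) ^ j)⁻¹ := by rw [mul_inv]; ring
        _ ≤ α₂ * i.η⁻¹ * 1 := by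
            apply mul_le_mul_of_nonneg_left (inv_le_one_of_one_le₀ hLj) (by positivity)
        _ = α₂ * i.η⁻¹ := mul_one _
    · rw [hA0 y τ fun j hj hs => hmem ⟨j, hj, hs⟩, norm_zero]
      positivity
  have hgrad : ∀ (y : Site d) (κ τ : Fin d), ‖covDerivFwd i.η U₀ κ (fun z => A' z τ) y‖ ≤ 2 * α₂ * i.η⁻¹ * i.η⁻¹ := by
    intro y κ τ
    unfold covDerivFwd
    rw [norm_smul, norm_inv, Real.norm_eq_abs, abs_of_pos hη]
    have h1 : ‖B7Eq78Linearization.conjR (U₀ y κ) (A' (y + e κ) τ) - A' y τ‖ ≤ α₂ * i.η⁻¹ + α₂ * i.η⁻¹ := by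
      calc ‖B7Eq78Linearization.conjR (U₀ y κ) (A' (y + e κ) τ) - A' y τ‖
          ≤ ‖B7Eq78Linearization.conjR (U₀ y κ) (A' (y + e κ) τ)‖ + ‖A' y τ‖ := norm_sub_le _ _
        _ ≤ α₂ * i.η⁻¹ + α₂ * i.η⁻¹ := by
            rw [B8Ineq132.norm_conjR (hU₀1 y κ)]
            exact add_le_add (hAglob _ _) (hAglob _ _)
    calc i.η⁻¹ * ‖B7Eq78Linearization.conjR (U₀ y κ) (A' (y + e κ) τ) - A' y τ‖
        ≤ i.η⁻¹ * (α₂ * i.η⁻¹ + α₂ * i.η⁻¹) := mul_le_mul_of_nonneg_left h1 (by positivity)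
      _ = 2 * α₂ * i.η⁻¹ * i.η⁻¹ := by ring
  have hJbd : Bdd L m i.η (-(3 : ℝ)) (fun j (b : Site d × Fin d) => BondTouches (i.Ω j) b.1 b.2)
      (fun b => Jcur i.η U₀ A' b.2 b.1) :=
    bdd_neg_three_of_pointwise hL hη fun b => norm_Jcur_le_of_grad hη hU₀1 hgrad b.2 b.1
  -- |J̃|₍₋₃₎ ≤ |J|₍₋₃₎ + c₆₉ M α₀ |A′|₍₋₁₎ + q |B₁| (pointwise: (3.26) with (3.69), the Landau condition, (3.16))
  have hJt : bondNorm L m i.η (-(3 : ℝ)) i.Ω Jt ≤ nJ + c69 * M * α₀ * a + q * nB := by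
    have e3 : (-(3 : ℝ)) = -((3 : ℕ) : ℝ) := by norm_num
    refine B8ScaledSupNorm.msup_le (by positivity) fun j hj b hb => ?_
    have hw : weight L i.η (-(3 : ℝ)) j = ((L : ℝ) ^ j * i.η) ^ 3 := by
      rw [e3, B8ScaledSupNorm.weight_neg_natCast]
    have hw0 : 0 ≤ ((L : ℝ) ^ j * i.η) ^ 3 := by positivity
    have h1 : weight L i.η (-(3 : ℝ)) j * ‖Jcur i.η U₀ A' b.2 b.1‖ ≤ nJ := by
      rw [hnJ_def]; exact B8ScaledSupNorm.weight_mul_norm_le_msup hJbd hj hb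
    have h2 : ((L : ℝ) ^ j * i.η) ^ 3 * ‖(ops M i m).Dp U₀ A' b.1 b.2‖ ≤ c69 * M * α₀ * a := by
      rw [ha_def]; exact hcurv α₀ U₀ hU₀ hα₀ hInA A' hOn j hj b.1 b.2 hb
    have h4 : ((L : ℝ) ^ j * i.η) ^ 3 * ‖(ops M i m).QQ U₀ A' b.1 b.2‖ ≤ q * nB := by
      rw [hnB_def]; exact havg U₀ hU₀ A' hOn j hj b.1 b.2 hb
    have hsum : ‖Jt b.1 b.2‖ ≤
        ‖Jcur i.η U₀ A' b.2 b.1‖ + ‖(ops M i m).Dp U₀ A' b.1 b.2‖ + ‖(ops M i m).QQ U₀ A' b.1 b.2‖ := by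
      rw [hJtb, hDRD b.1 b.2, add_zero]
      exact norm_add₃_le
    rw [hw] at h1 ⊢
    calc ((L : ℝ) ^ j * i.η) ^ 3 * ‖Jt b.1 b.2‖
        ≤ ((L : ℝ) ^ j * i.η) ^ 3 *
            (‖Jcur i.η U₀ A' b.2 b.1‖ + ‖(ops M i m).Dp U₀ A' b.1 b.2‖ + ‖(ops M i m).QQ U₀ A' b.1 b.2‖) :=
          mul_le_mul_of_nonneg_left hsum hw0
      _ = ((L : ℝ) ^ j * i.η) ^ 3 * ‖Jcur i.η U₀ A' b.2 b.1‖ + ((L : ℝ) ^ j * i.η) ^ 3 * ‖(ops M i m).Dp U₀ A' b.1 b.2‖ +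
            ((L : ℝ) ^ j * i.η) ^ 3 * ‖(ops M i m).QQ U₀ A' b.1 b.2‖ := by ring
      _ ≤ nJ + c69 * M * α₀ * a + q * nB := add_le_add (add_le_add h1 h2) h4
  -- Theorem 3.3's γ = −3 entries at J̃ ((3.47) ⇒ (1.59) lines 1, 2, 4), and the Hölder entry (line 5)
  obtain ⟨hG0, hG1, hG3⟩ := hglob α₀ U₀ hU₀ hU₀p hα₀ hα₀T hInA Jt hJtper
  rw [hGJ] at hG0 hG1 hG3
  have hline1 : a ≤ B₀ * bondNorm L m i.η (-(3 : ℝ)) i.Ω Jt := by rw [ha_def]; exact hG0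
  have hline5 : msup L m i.η (-(2 + β))
      (fun j (q : Fin d × Fin d × (Site d × Site d)) => q.2.2 ∈ AdmPair i.η len ∧ q.2.2.1 ∈ i.Ω j ∧ q.2.2.2 ∈ i.Ω j)
      (fun q => hquot i.η β len U₀ (covDerivFwd i.η U₀ q.1 (fun z => A' z q.2.1)) q.2.2) ≤
      max 0 Cβ * bondNorm L m i.η (-(3 : ℝ)) i.Ω Jt := by
    have h := hhol α₀ U₀ hU₀ hU₀p hα₀ hα₀T hInA Jt hJtper
    rw [hGJ] at h
    exact h.trans (mul_le_mul_of_nonneg_right (le_max_right _ _) (B8ScaledSupNorm.msup_nonneg L m hη.le _ _ _))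
  -- the a-priori (Neumann) step, in the concrete norms
  have hJJ : bondNorm L m i.η (-(3 : ℝ)) i.Ω (fun x μ => pdiv i.η U₀ (plaqCovDeriv i.η U₀ A') μ x) = nJ := by
    rw [hnJ_def]; rfl
  rw [← ha_def, ← hnJ_def, ← hnB_def]
  exact apriori_arith hB₀ hq hκ' hθ ha0 hnJ0 hnB0 (le_max_left 0 _) hJJ hJt hline1 hG1 hG3 hline5

end Supply

/-! ## §2  For the genuine torus record over the class `ΛbP`: the structural binders discharged -/

section Genuine

variable (L : ℕ) (τ : 𝔸 →ₗ[ℂ] ℂ) (P : ℕ) [Nontrivial 𝔸] [FiniteDimensional ℝ 𝔸] [NeZero P]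

/-- ★★★ **THE BOTH-POINTS SOCKET FOR THE GENUINE TORUS RECORD OVER A GENERIC CLASS `ΛbP`**: `2 ≤ d`, `2 ≤ L`, faithful Hermitian tracial `τ` with `C_τ`, `Lᵐ ∣ P`,
`(P∕Lʲ)`-periodic class sections and EDITION P₀'s law `LevelSepPP0 L m i.Ω ΛbP s`: `InvAtHIPer` + `GlobAtIPer` + `HolderAtIH2Per` for `opsAllZdPer τ L P ΛbP ops₀` ⟹
`SockB9P3H2Per P L B₀′ B₀β′ cP β len i.η m i.Ω i.Λs ΛbP` (`PerAtU`, `CurvAtInAk`, `AvgAtP`, `LandauAtUPer` discharged by g22's lemmas) — g23's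
`sockB9P3H2Per_opsAllZdPer_of_binders` with `i.Λb ↦ ΛbP`. [cite: Balaban1985RegularSpaces, (1.58)–(1.59) p.86, Prop. 3 p.87, (1.31) p.82, p.77 («Ω_j = T_η»); Balaban1985BackgroundPropagators, Thm 3.3 p.399, Thm 3.11 p.416, (3.26)–(3.27) p.395, (3.69) p.404, (3.16) p.393] -/
theorem sockB9P3H2Per_opsAllZdPer_of_binders_class (hd2 : 2 ≤ d) (hL : 2 ≤ L) (hτp : ∀ a : 𝔸, a ≠ 0 → 0 < (τ (star a * a)).re)
    (hτt : ∀ a b : 𝔸, τ (a * b) = τ (b * a)) (hτs : ∀ a : 𝔸, τ (star a) = starRingEnd ℂ (τ a))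
    {Cτ : ℝ} (hCτ : ∀ x y : 𝔸, |(τ (star x * y)).re| ≤ Cτ * ‖x‖ * ‖y‖)
    (ops₀ : ℝ → ZdIdx d L → ℕ → OpsZd d 𝔸) {M : ℝ} (hM1 : 1 ≤ M) (i : ZdIdx d L) (hΩ : i.Ω 0 = Set.univ) (ΛbP : ℕ → ℕ → Set (Site d × Fin d))
    {m s : ℕ} (hdvd : L ^ m ∣ P) (hΛ : ∀ j, j ≤ m → ∀ κ : Fin d, IsPeriodic (P / L ^ j) (fun z => (z, κ) ∈ ΛbP m j)) (hlaw : LevelSepPP0 L m i.Ω ΛbP s)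
    {aI aT B₀ Cβ β : ℝ} {len : Site d → ℝ}
    (hinv : InvAtHIPer P L (opsAllZdPer τ L P ΛbP ops₀) aI M i m)
    (hglob : GlobAtIPer P L (opsAllZdPer τ L P ΛbP ops₀) aT B₀ M i m) (hhol : HolderAtIH2Per P L (opsAllZdPer τ L P ΛbP ops₀) aT Cβ β len M i m)
    (hB₀ : 0 < B₀) :
    SockB9P3H2Per (𝔸 := 𝔸) P L (max 1 (2 * B₀ * max 1 (qQ d L Cτ (betaTau τ) s))) (2 * max 0 Cβ * max 1 (qQ d L Cτ (betaTau τ) s))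
      (min (1 / 16) (min aI (min aT (1 / (2 * B₀ * (14 * ((d - 1 : ℕ) : ℝ)) * M + 1))))) β len i.η m i.Ω i.Λs ΛbP := by
  have hL1 : 1 ≤ L := le_trans (by norm_num) hL
  have hbox : ∀ j, 1 ≤ j → j ≤ m → ∀ c ∈ ΛbP m j, ∀ x, InBox (loK L j c.1) (bondHiK L j c.1 c.2) x → x ∈ i.Ω (j - 1) :=
    fun j hj1 hj c hc x hx => (hlaw j hj c hc x hx).1 hj1
  have hq : 0 ≤ qQ d L Cτ (betaTau τ) s := by
    have hCτ0 : 0 ≤ Cτ := by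
      have h := hCτ 1 1
      rw [star_one, one_mul, norm_one, mul_one, mul_one] at h
      exact le_trans (abs_nonneg _) h
    have hβ : 0 ≤ betaTau τ := by
      unfold betaTau
      split_ifs
      · exact Finset.sum_nonneg fun i _ => mul_nonneg (norm_nonneg _) (norm_nonneg _)
      · exact le_rfl
    have hα : 0 ≤ B9Eq316AveragingTransposeZd.alphaQ d L := (B9Eq316AveragingTransposeZd.alphaQ_pos d hL1).le
    have hθ : 0 ≤ B7Prop5GeneralLevels.thetaGen d L (B9Eq316AveragingTransposeZd.alphaQ d L) := by
      unfold B7Prop5GeneralLevels.thetaGen; positivity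
    unfold qQ; positivity
  haveI : NeZero L := ⟨by omega⟩
  exact sockB9P3H2Per_at_univ_class P L (opsAllZdPer τ L P ΛbP ops₀) hd2 hL1 hM1 i hΩ hinv (curvAtInAk_opsAllZdPer L τ P hL1 ΛbP ops₀ hM1 i m)
    (landauAtUPer_opsAllZdPer L τ P hτp hτt hτs ΛbP ops₀ M i hΩ hdvd) ΛbP
    (avgAtP_opsAllZdPer₀ L τ P hd2 hL hCτ ΛbP ops₀ M i m hlaw) hglob hhol
    (perAtU_opsAllZdPer L τ P hL hτp hτt hτs ΛbP ops₀ M i hdvd hΛ hbox) (by positivity) hq hB₀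

/-- ★★★ **THE BOTH-POINTS SOCKET FOR THE GENUINE TORUS RECORD OVER PRINT'S CLASS (1.31)** — the N05 consumers' displayed hypothesis (dag-n05-d (13)′α, n05-w1's
Prop-3 servers `B8Prop3PrintedZdGF3P2GammaOfSockPer`): `SockB9P3H2Per P L B₀′ B₀β′ cP β len i.η m i.Ω i.Λs (fun m l => towerBondsP L i.Ω (i.Λs m) l)` from
`InvAtHIPer` + `GlobAtIPer` + `HolderAtIH2Per` for the record `opsAllZdPer τ L P (fun m l => towerBondsP L i.Ω (i.Λs m) l) ops₀` (Q′ᵀQ′ of (1.31)'s bonds), the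
class sections `(P∕Lʲ)`-periodic and EDITION P₀'s law for the class (n05's `levelSepPP0_of_levelSepPP ∘ IdxB8SubD.levelSepPP_towerBondsP`).
[cite: Balaban1985RegularSpaces, (1.58)–(1.59) p.86, Prop. 3 p.87, (1.31) p.82, p.77 («Ω_j = T_η»); Balaban1985BackgroundPropagators, Thm 3.3 p.399, Thm 3.11 p.416, (3.26)–(3.27) p.395; Balaban1984PropagatorsII, (2.3) p.224] -/
theorem sockB9P3H2Per_opsAllZdPer_towerBondsP (hd2 : 2 ≤ d) (hL : 2 ≤ L) (hτp : ∀ a : 𝔸, a ≠ 0 → 0 < (τ (star a * a)).re)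
    (hτt : ∀ a b : 𝔸, τ (a * b) = τ (b * a)) (hτs : ∀ a : 𝔸, τ (star a) = starRingEnd ℂ (τ a))
    {Cτ : ℝ} (hCτ : ∀ x y : 𝔸, |(τ (star x * y)).re| ≤ Cτ * ‖x‖ * ‖y‖)
    (ops₀ : ℝ → ZdIdx d L → ℕ → OpsZd d 𝔸) {M : ℝ} (hM1 : 1 ≤ M) (i : ZdIdx d L) (hΩ : i.Ω 0 = Set.univ)
    {m s : ℕ} (hdvd : L ^ m ∣ P) (hΛ : ∀ j, j ≤ m → ∀ κ : Fin d, IsPeriodic (P / L ^ j) (fun z => (z, κ) ∈ towerBondsP L i.Ω (i.Λs m) j))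
    (hlaw : LevelSepPP0 L m i.Ω (fun m l => towerBondsP L i.Ω (i.Λs m) l) s)
    {aI aT B₀ Cβ β : ℝ} {len : Site d → ℝ}
    (hinv : InvAtHIPer P L (opsAllZdPer τ L P (fun m l => towerBondsP L i.Ω (i.Λs m) l) ops₀) aI M i m)
    (hglob : GlobAtIPer P L (opsAllZdPer τ L P (fun m l => towerBondsP L i.Ω (i.Λs m) l) ops₀) aT B₀ M i m)
    (hhol : HolderAtIH2Per P L (opsAllZdPer τ L P (fun m l => towerBondsP L i.Ω (i.Λs m) l) ops₀) aT Cβ β len M i m)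
    (hB₀ : 0 < B₀) :
    SockB9P3H2Per (𝔸 := 𝔸) P L (max 1 (2 * B₀ * max 1 (qQ d L Cτ (betaTau τ) s))) (2 * max 0 Cβ * max 1 (qQ d L Cτ (betaTau τ) s))
      (min (1 / 16) (min aI (min aT (1 / (2 * B₀ * (14 * ((d - 1 : ℕ) : ℝ)) * M + 1))))) β len i.η m i.Ω i.Λs
      (fun m l => towerBondsP L i.Ω (i.Λs m) l) :=
  sockB9P3H2Per_opsAllZdPer_of_binders_class L τ P hd2 hL hτp hτt hτs hCτ ops₀ hM1 i hΩ (fun m l => towerBondsP L i.Ω (i.Λs m) l) hdvd hΛ hlaw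
    hinv hglob hhol hB₀

end Genuine

end Literature.MathematicalPhysics.QuantumFieldTheory.Balaban1983to89.B9SupplySockB9P3ZdH2PerClass
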